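import Summits.Ventures.PercRepro.C026C028Recursion

/-!
# The reduction: C-028(c) on every marked multigraph follows from its one-edge steps (p6, gen 15;
mine-3 MINE3-GLUING v4 §7 (5), in the weight vocabulary)

Induction on the number of fractional edges of `p` (`fracEdges`, as in `C026At_of_saConst_all`).  Base:
a 0/1 weight vector is a point mass, every row is `0` or `1`, and the C-028 defect is `0`
(`C028At_of_isZeroOne`).  Step at a fractional edge `e`, with the induction hypothesis «C-028(c) for
every marking of `p[e:=0]` and of `p[e:=1]`»: loops (`C028At_of_loop`), mark–`c` edges
(`C028At_of_markC`) and `a`–`b` edges (`C028At_of_edge_ab`) are theorems (`C026C028Recursion`); the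
three remaining shapes are the STEP HYPOTHESES of the reduction — (A) an edge joining a mark `a` (or
`b`, by the `a ↔ b` symmetry) to a non-mark, (C) an edge joining the probe `c` to a non-mark, (N) an edge
off the marks.  `C028At_of_steps` then gives C-028(c) on every marked multigraph at every weight vector.
In mine-3's graph vocabulary the induction contracts edges and only ever needs (A) (or only (C)); the
weight-world image of that choice is the sure-cluster form of (A), which this file does not type.
-/

namespace PercRepro

open Finset

namespace MultiGraph

variable {V E : Type*} (G : MultiGraph V E) [Fintype E] [DecidableEq E]

/-! ### Loops: the two minors agree -/

omit [Fintype E] in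
/-- At a loop, forcing the edge open or closed gives the same connections. -/
theorem conn_update_true_iff_update_false_of_loop {e : E} (he : G.fst e = G.snd e) (ω : Config E)
    (u v : V) :
    G.Conn (Function.update ω e true) u v ↔ G.Conn (Function.update ω e false) u v := by
  constructor
  · intro h
    have hidem : Function.update ω e true =
        Function.update (Function.update ω e false) e true := by
      rw [Function.update_idem]
    rw [hidem, conn_update_true_iff] at h
    rcases h with h | ⟨h1, h2⟩ | ⟨h1, h2⟩
    · exact h
    · rw [he] at h1; exact h1.trans h2
    · rw [← he] at h1; exact h1.trans h2
  · intro h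
    refine h.mono (fun e' => ?_) 
    by_cases h' : e' = e
    · subst h'; simp
    · simp [Function.update_of_ne h']

omit [Fintype E] in
/-- At a loop, the open and closed lifts of every `k = 3` partition row coincide. -/
theorem lift_partition_eq_of_loop {e : E} (he : G.fst e = G.snd e) (a b c : V) (r : Fin 3 → ℕ) :
    lift e true (G.partitionEvent ![a, b, c] r) = lift e false (G.partitionEvent ![a, b, c] r) := by
  ext ω
  simp only [mem_lift, G.mem_partitionEvent_three a b c r,
    G.conn_update_true_iff_update_false_of_loop he ω]

/-- At a loop, every row of `p[e:=1]` equals the row of `p[e:=0]`. -/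
theorem law3_update_one_eq_update_zero_of_loop (p : E → ℝ) {e : E} (he : G.fst e = G.snd e)
    (a b c : V) (s : Fin 5) :
    G.law3 (Function.update p e 1) a b c s = G.law3 (Function.update p e 0) a b c s := by
  unfold law3
  rw [prob_update_one_eq_prob_lift, prob_update_zero_eq_prob_lift, G.lift_partition_eq_of_loop he]

/-- At a loop, `I_A = 0`. -/
theorem pivA26_eq_zero_of_loop (p : E → ℝ) {e : E} (he : G.fst e = G.snd e) (a b c : V) :
    G.pivA26 p e a b c = 0 := by
  rw [pivA26_eq, prob_update_one_eq_prob_lift, prob_update_zero_eq_prob_lift,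
    G.lift_true_eq_lift_false_of_loop he, sub_self]

/-- **The loop step**: at a loop, C-028(c) at `p[e:=0]` gives C-028(c) at `p`. -/
theorem C028At_of_loop (p : E → ℝ) {e : E} (he : G.fst e = G.snd e) {a b c : V}
    (h0 : G.C028At (Function.update p e 0) a b c) : G.C028At p a b c := by
  have hrow := G.law3_update_one_eq_update_zero_of_loop p he a b c
  have hd1 : G.c028Cov (Function.update p e 1) a b c = G.c028Cov (Function.update p e 0) a b c := by
    unfold c028Cov
    rw [hrow 0, hrow 1, hrow 2, hrow 3]
  have hd : G.c028Cov p a b c = G.c028Cov (Function.update p e 0) a b c := by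
    rw [G.c028Cov_rec p e a b c, hd1, G.pivA26_eq_zero_of_loop p he]
    ring
  have h2 : G.law3 p a b c 2 = G.law3 (Function.update p e 0) a b c 2 := by
    rw [G.law3_split_edge p e a b c 2, hrow 2]
    ring
  have h3 : G.law3 p a b c 3 = G.law3 (Function.update p e 0) a b c 3 := by
    rw [G.law3_split_edge p e a b c 3, hrow 3]
    ring
  unfold C028At at h0 ⊢
  rw [hd, h2, h3]
  exact h0

/-! ### The base: 0/1 weight vectors -/

/-- At a 0/1 weight vector the C-028 defect is `0`: C-028(c) holds. -/
theorem C028At_of_isZeroOne {p : E → ℝ} (hp : IsZeroOne p) (a b c : V) : G.C028At p a b c := by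
  have hsum := law3_sum_eq_one G p a b c
  unfold C028At c028Cov
  rcases G.law3_zeroOne hp a b c 0 with h0 | h0 <;>
    rcases G.law3_zeroOne hp a b c 1 with h1 | h1 <;>
    rcases G.law3_zeroOne hp a b c 2 with h2 | h2 <;>
    rcases G.law3_zeroOne hp a b c 3 with h3 | h3 <;>
    rcases G.law3_zeroOne hp a b c 4 with h4 | h4 <;>
    simp only [h0, h1, h2, h3, h4] at hsum ⊢ <;> (try norm_num at hsum) <;> norm_num

/-! ### The reduction -/

/-- `e` joins `u` and `v` (in either orientation). -/
def C028Joins (e : E) (u v : V) : Prop :=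
  (G.fst e = u ∧ G.snd e = v) ∨ (G.fst e = v ∧ G.snd e = u)

/-- The induction hypothesis of the one-edge induction at `(p, e)`: C-028(c) for every marking of both
minors. -/
def C028Minors (p : E → ℝ) (e : E) : Prop :=
  (∀ a b c : V, G.C028At (Function.update p e 0) a b c) ∧
    (∀ a b c : V, G.C028At (Function.update p e 1) a b c)

/-- **Step (A)** (mine-3 §7 (5)): at a fractional edge joining the mark `a` to a non-mark `x`, C-028(c)
for every marking of both minors gives C-028(c) at `p`. -/
def C028StepMark : Prop :=
  ∀ (p : E → ℝ) (e : E) (a b c x : V), IsProb p → p e ≠ 0 → p e ≠ 1 → G.C028Joins e a x →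
    x ≠ a → x ≠ b → x ≠ c → G.C028Minors p e → G.C028At p a b c

/-- **Step (C)** (mine-3's (B)): the same at a fractional edge joining the probe `c` to a non-mark. -/
def C028StepProbe : Prop :=
  ∀ (p : E → ℝ) (e : E) (a b c x : V), IsProb p → p e ≠ 0 → p e ≠ 1 → G.C028Joins e c x →
    x ≠ a → x ≠ b → x ≠ c → G.C028Minors p e → G.C028At p a b c

/-- **Step (N)**: the same at a fractional edge off the marks. -/
def C028StepOff : Prop :=
  ∀ (p : E → ℝ) (e : E) (a b c : V), IsProb p → p e ≠ 0 → p e ≠ 1 →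
    G.fst e ≠ a → G.fst e ≠ b → G.fst e ≠ c → G.snd e ≠ a → G.snd e ≠ b → G.snd e ≠ c →
    G.C028Minors p e → G.C028At p a b c

/-- The one-edge step at an arbitrary fractional edge, from the three step hypotheses and the
theorems for loops, mark–`c` edges and `a`–`b` edges. -/
theorem C028At_step (hA : G.C028StepMark) (hC : G.C028StepProbe) (hN : G.C028StepOff)
    {p : E → ℝ} (hp : IsProb p) {e : E} (he0 : p e ≠ 0) (he1 : p e ≠ 1) (hIH : G.C028Minors p e)
    (a b c : V) : G.C028At p a b c := by
  classical
  have h0 := hIH.1 a b c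
  by_cases hloop : G.fst e = G.snd e
  · exact G.C028At_of_loop p hloop h0
  -- the endpoints against the marks
  by_cases hfa : G.fst e = a
  · by_cases hsb : G.snd e = b
    · exact G.C028At_of_edge_ab hp (Or.inl ⟨hfa, hsb⟩) c h0
    by_cases hsc : G.snd e = c
    · exact G.C028At_of_markC hp (Or.inl (Or.inl ⟨hfa, hsc⟩)) h0
    have hsa : G.snd e ≠ a := fun h => hloop (hfa.trans h.symm)
    exact hA p e a b c (G.snd e) hp he0 he1 (Or.inl ⟨hfa, rfl⟩) hsa hsb hsc hIH
  by_cases hfb : G.fst e = b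
  · by_cases hsa : G.snd e = a
    · exact G.C028At_of_edge_ab hp (Or.inr ⟨hfb, hsa⟩) c h0
    by_cases hsc : G.snd e = c
    · exact G.C028At_of_markC hp (Or.inr (Or.inl ⟨hfb, hsc⟩)) h0
    have hsb : G.snd e ≠ b := fun h => hloop (hfb.trans h.symm)
    -- step (A) for the mark `b`, through the `a ↔ b` symmetry
    exact (G.C028At_swap_ab p a b c).2
      (hA p e b a c (G.snd e) hp he0 he1 (Or.inl ⟨hfb, rfl⟩) hsb hsa hsc
        ⟨fun a' b' c' => hIH.1 a' b' c', fun a' b' c' => hIH.2 a' b' c'⟩)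
  by_cases hfc : G.fst e = c
  · by_cases hsa : G.snd e = a
    · exact G.C028At_of_markC hp (Or.inl (Or.inr ⟨hfc, hsa⟩)) h0
    by_cases hsb : G.snd e = b
    · exact G.C028At_of_markC hp (Or.inr (Or.inr ⟨hfc, hsb⟩)) h0
    have hsc : G.snd e ≠ c := fun h => hloop (hfc.trans h.symm)
    exact hC p e a b c (G.snd e) hp he0 he1 (Or.inl ⟨hfc, rfl⟩) hsa hsb hsc hIH
  -- `fst e` is not a mark
  by_cases hsa : G.snd e = a
  · exact hA p e a b c (G.fst e) hp he0 he1 (Or.inr ⟨rfl, hsa⟩) hfa hfb hfc hIH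
  by_cases hsb : G.snd e = b
  · exact (G.C028At_swap_ab p a b c).2
      (hA p e b a c (G.fst e) hp he0 he1 (Or.inr ⟨rfl, hsb⟩) hfb hfa hfc
        ⟨fun a' b' c' => hIH.1 a' b' c', fun a' b' c' => hIH.2 a' b' c'⟩)
  by_cases hsc : G.snd e = c
  · exact hC p e a b c (G.fst e) hp he0 he1 (Or.inr ⟨rfl, hsc⟩) hfa hfb hfc hIH
  exact hN p e a b c hp he0 he1 hfa hfb hfc hsa hsb hsc hIH

/-- **THE REDUCTION** (mine-3 §7 (5), weight-world form): the steps (A), (C), (N) at fractional edges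
give ROW C-028(c) on every marked multigraph at every weight vector — hence C-035 and C-026
(`C026At_of_C028At`). -/
theorem C028At_of_steps (hA : G.C028StepMark) (hC : G.C028StepProbe) (hN : G.C028StepOff) :
    ∀ p : E → ℝ, IsProb p → ∀ a b c : V, G.C028At p a b c := by
  suffices H : ∀ n : ℕ, ∀ p : E → ℝ, IsProb p → (fracEdges p).card = n →
      ∀ a b c : V, G.C028At p a b c by
    intro p hp
    exact H _ p hp rfl
  intro n
  refine Nat.strong_induction_on n ?_
  intro n ih p hp hn a b c
  by_cases hlive : fracEdges p = ∅
  · exact G.C028At_of_isZeroOne (isZeroOne_of_fracEdges_eq_empty hlive) a b c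
  · obtain ⟨e, he⟩ := Finset.nonempty_iff_ne_empty.2 hlive
    have he' := he
    simp only [fracEdges, Finset.mem_filter, Finset.mem_univ, true_and] at he'
    have hIH : G.C028Minors p e :=
      ⟨fun a' b' c' => ih _ (hn ▸ card_fracEdges_update_lt he (Or.inl rfl)) _
          (hp.update e ⟨le_rfl, zero_le_one⟩) rfl a' b' c',
        fun a' b' c' => ih _ (hn ▸ card_fracEdges_update_lt he (Or.inr rfl)) _
          (hp.update e ⟨zero_le_one, le_rfl⟩) rfl a' b' c'⟩
    exact G.C028At_step hA hC hN hp he'.1 he'.2 hIH a b c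

/-- **C-026 from the steps**: with (A), (C), (N), ROW C-026 holds on every marked multigraph at every
weight vector. -/
theorem C026At_of_steps {V E : Type} (G : MultiGraph V E) [Fintype E] [DecidableEq E]
    (hA : G.C028StepMark) (hC : G.C028StepProbe) (hN : G.C028StepOff) :
    ∀ p : E → ℝ, IsProb p → ∀ a b c : V, G.C026At p a b c :=
  fun p hp a b c => G.C026At_of_C028At hp (G.C028At_of_steps hA hC hN p hp a b c)

end MultiGraph

end PercRepro
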